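import Literature.AlgebraicGeometry.Motives.MixedHodgeStructureRadical
import Literature.AlgebraicGeometry.Motives.MixedHodgeStructureSemisimpleHodgeClasses
import Literature.AlgebraicGeometry.Motives.MixedHodgeStructureTateHomHodgeClasses
import HarnessLib

/-!
# Hodge classes live in the socle; images of Hodge classes under arbitrary morphisms

Two universal properties of the socle / radical of a mixed Hodge structure (largest semisimple sub-object /
smallest sub-object with semisimple quotient in the abelian category of MHS — Cattani–El Zein–Griffiths–Lê,
*Hodge Theory*, Thm. 3.2.18, p. 270): **morphisms from a semisimple MHS land in the socle, morphisms to a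
semisimple MHS kill the radical**. Since a Hodge class of type `(p,p)` is a morphism `ℚ(-p) → H` (Arapura, §1;
the tree's `Hom.ofHodgeClass`) and `ℚ(-p)` is simple, **`Hdgᵖ(H) ⊆ soc H`** and `Hdgᵖ(H) = Hdgᵖ(soc H)`.
Combined with Jannsen's lifting of Hodge classes along morphisms out of *semisimple* MHS (LNM 1400, 7.8 a); the
tree's `IsSemisimple.map_hodgeClasses_eq_inf_range`) this gives, for an ARBITRARY morphism `f : H → H'` of MHS on
finite-dimensional spaces, **`f(Hdgᵖ H) = Hdgᵖ(H') ∩ f(soc H)`** (`Hom.map_hodgeClasses_eq_inf_map_socle`): a Hodge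
class of `H'` lifts to a Hodge class of `H` iff it lies in the image of the socle.
Namespace `MixedHodgeStructure`; everything proved, no named facts.

## References

* [CattaniElZeinGriffithsLe2014] E. Cattani et al. (eds.), Hodge Theory (2014), Thm. 3.2.18, p. 270.
* [Jannsen1990MixedMotives] U. Jannsen, Mixed Motives and Algebraic K-Theory, LNM 1400 (1990), 7.8, Thm. 7.9.
* [Arapura2022] D. Arapura, Hodge cycles and the Leray filtration, Pacific J. Math. 319 (2022), §1.
-/

noncomputable section

namespace Literature.AlgebraicGeometry.Motives

namespace MixedHodgeStructure

universe u v

variable {V : Type u} [AddCommGroup V] [Module ℚ V] [FiniteDimensional ℚ V]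
variable {V' : Type v} [AddCommGroup V'] [Module ℚ V'] [FiniteDimensional ℚ V']
variable {H : MixedHodgeStructure V} {H' : MixedHodgeStructure V'}

open Module

/-! ### §1 Morphisms from / to semisimple MHS -/

/-- **A morphism out of a semisimple MHS lands in the socle** (its image is a semisimple sub-MHS).
[cite: CattaniElZeinGriffithsLe2014, Thm. 3.2.18 and p. 270] -/
theorem IsSemisimple.range_le_socle (h' : H'.IsSemisimple) (f : Hom H' H) :
    LinearMap.range f.toLinearMap ≤ (socle H).toSubmodule := by
  rw [← Hom.range_toSubmodule]
  exact le_socle f.range (h'.range f)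

/-- Elementwise form. [cite: CattaniElZeinGriffithsLe2014, Thm. 3.2.18 and p. 270] -/
theorem IsSemisimple.apply_mem_socle (h' : H'.IsSemisimple) (f : Hom H' H) (x : V') :
    f.toLinearMap x ∈ (socle H).toSubmodule :=
  h'.range_le_socle f (LinearMap.mem_range_self _ x)

omit [FiniteDimensional ℚ V'] in
/-- **A morphism to a semisimple MHS kills the radical** (`H / Ker f ≅ Im f` is semisimple).
[cite: CattaniElZeinGriffithsLe2014, Thm. 3.2.18 and p. 270] -/
theorem IsSemisimple.radical_le_ker (h' : H'.IsSemisimple) (f : Hom H H') :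
    (radical H).toSubmodule ≤ LinearMap.ker f.toLinearMap := by
  rw [← Hom.ker_toSubmodule]
  exact radical_le f.ker ((h'.range' f).of_bijective' f.coimageToRange f.coimageToRange_bijective)

omit [FiniteDimensional ℚ V'] in
/-- Elementwise form. [cite: CattaniElZeinGriffithsLe2014, Thm. 3.2.18 and p. 270] -/
theorem IsSemisimple.apply_eq_zero_of_mem_radical (h' : H'.IsSemisimple) (f : Hom H H') {x : V}
    (hx : x ∈ (radical H).toSubmodule) : f.toLinearMap x = 0 :=
  LinearMap.mem_ker.1 (h'.radical_le_ker f hx)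

omit [FiniteDimensional ℚ V] in
/-- The socle is the largest image of a morphism from a semisimple MHS (attained by `soc H ↪ H`).
[cite: CattaniElZeinGriffithsLe2014, Thm. 3.2.18 and p. 270] -/
theorem socle_toSubmodule_eq_range_subtype : (socle H).toSubmodule = LinearMap.range (socle H).subtype.toLinearMap :=
  (Submodule.range_subtype _).symm

/-- The radical is the smallest kernel of a morphism to a semisimple MHS (attained by `H ↠ H / rad H`).
[cite: CattaniElZeinGriffithsLe2014, Thm. 3.2.18 and p. 270] -/
theorem radical_toSubmodule_eq_ker_mkQ : (radical H).toSubmodule = LinearMap.ker (radical H).mkQ.toLinearMap :=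
  (Submodule.ker_mkQ _).symm

/-! ### §2 Hodge classes lie in the socle -/

variable (H)

/-- **`Hdgᵖ(H) ⊆ soc H`**: a Hodge class `v` is the image of `1` under the morphism `ℚ(-p) → H`, `q ↦ q • v`, and
`ℚ(-p)` is semisimple. [cite: Arapura2022, §1 (p. 3)] [cite: CattaniElZeinGriffithsLe2014, p. 270] -/
theorem hodgeClasses_le_socle (p : ℤ) : H.hodgeClasses p ≤ (socle H).toSubmodule := fun v hv => by
  have h := (HodgeStructure.isSemisimple_tate (-p)).apply_mem_socle (Hom.ofHodgeClass H p ⟨v, hv⟩) 1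
  rwa [Hom.ofHodgeClass_toLinearMap_apply, one_smul] at h

/-- **`Hdgᵖ(H) = Hdgᵖ(soc H)`** (pushed into `V`). [cite: Arapura2022, §1 (p. 3)] [cite: CattaniElZeinGriffithsLe2014, p. 270] -/
theorem hodgeClasses_eq_map_hodgeClasses_socle (p : ℤ) : H.hodgeClasses p =
    ((socle H).toMixedHodgeStructure.hodgeClasses p).map (socle H).toSubmodule.subtype := by
  rw [SubMixedHodgeStructure.map_subtype_hodgeClasses]
  exact (inf_eq_left.2 (hodgeClasses_le_socle H p)).symm

/-- More generally `Hdgᵖ(H) = Hdgᵖ(S)` for every sub-MHS `S ⊇ soc H`. [cite: Arapura2022, §1 (p. 3)]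
[cite: CattaniElZeinGriffithsLe2014, p. 270] -/
theorem hodgeClasses_eq_map_hodgeClasses_of_socle_le (p : ℤ) (S : SubMixedHodgeStructure H)
    (hS : (socle H).toSubmodule ≤ S.toSubmodule) :
    H.hodgeClasses p = (S.toMixedHodgeStructure.hodgeClasses p).map S.toSubmodule.subtype := by
  rw [SubMixedHodgeStructure.map_subtype_hodgeClasses]
  exact (inf_eq_left.2 ((hodgeClasses_le_socle H p).trans hS)).symm

/-- `dim Hdgᵖ(soc H) = dim Hdgᵖ(H)`. [cite: Arapura2022, §1 (p. 3)] -/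
theorem finrank_hodgeClasses_socle (p : ℤ) :
    finrank ℚ ((socle H).toMixedHodgeStructure.hodgeClasses p) = finrank ℚ (H.hodgeClasses p) := by
  rw [hodgeClasses_eq_map_hodgeClasses_socle H p]
  exact LinearEquiv.finrank_eq
    (Submodule.equivMapOfInjective _ (Submodule.injective_subtype (socle H).toSubmodule)
      ((socle H).toMixedHodgeStructure.hodgeClasses p))

/-- **`Hdgᵖ(H) = 0` when `soc H ∩ W_{2p} H = 0`** (Hodge classes lie in `soc H ∩ W_{2p} H`).
[cite: Arapura2022, §1 (p. 3)] [cite: CattaniElZeinGriffithsLe2014, p. 270] -/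
theorem hodgeClasses_eq_bot_of_socle_inf_W_eq_bot (p : ℤ) (h : (socle H).toSubmodule ⊓ H.W (2 * p) = ⊥) :
    H.hodgeClasses p = ⊥ :=
  eq_bot_iff.2 fun _ hv => h ▸ Submodule.mem_inf.2 ⟨hodgeClasses_le_socle H p hv, hodgeClasses_le_W H p hv⟩

/-- Dually, **every morphism `H → ℚ(-p)` kills `rad H`**. [cite: Arapura2022, §1 (p. 3)] [cite: CattaniElZeinGriffithsLe2014, p. 270] -/
theorem radical_le_ker_of_tate (p : ℤ) (f : Hom H (HodgeStructure.tate (-p)).toMixedHodgeStructure) :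
    (radical H).toSubmodule ≤ LinearMap.ker f.toLinearMap :=
  (HodgeStructure.isSemisimple_tate (-p)).radical_le_ker f

variable {H}

/-! ### §3 Images of Hodge classes under an arbitrary morphism -/

omit [FiniteDimensional ℚ V'] in
/-- `f(Hdgᵖ H) = (f ∘ (soc H ↪ H))(Hdgᵖ(soc H))`. [cite: Jannsen1990MixedMotives, 7.8] -/
theorem Hom.map_hodgeClasses_eq_map_comp_socle_subtype (f : Hom H H') (p : ℤ) :
    (H.hodgeClasses p).map f.toLinearMap =
      ((socle H).toMixedHodgeStructure.hodgeClasses p).map (f.comp (socle H).subtype).toLinearMap := by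
  rw [hodgeClasses_eq_map_hodgeClasses_socle H p, ← Submodule.map_comp, Hom.comp_toLinearMap]
  rfl

omit [FiniteDimensional ℚ V'] in
/-- **`f(Hdgᵖ H) = Hdgᵖ(H') ∩ f(soc H)` for every morphism `f : H → H'` of MHS**: the Hodge classes of `H` are those
of the semisimple `soc H`, to which Jannsen's lifting 7.8 a) applies. [cite: Jannsen1990MixedMotives, 7.8 and Thm. 7.9]
[cite: CattaniElZeinGriffithsLe2014, p. 270] -/
theorem Hom.map_hodgeClasses_eq_inf_map_socle (f : Hom H H') (p : ℤ) :
    (H.hodgeClasses p).map f.toLinearMap = H'.hodgeClasses p ⊓ (socle H).toSubmodule.map f.toLinearMap := by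
  rw [f.map_hodgeClasses_eq_map_comp_socle_subtype p,
    (isSemisimple_socle H).map_hodgeClasses_eq_inf_range (f.comp (socle H).subtype) p, Hom.comp_toLinearMap,
    LinearMap.range_comp]
  congr 2
  exact Submodule.range_subtype _

omit [FiniteDimensional ℚ V'] in
/-- **Lifting criterion**: a Hodge class `w` of `H'` is the image of a Hodge class of `H` iff `w ∈ f(soc H)`.
[cite: Jannsen1990MixedMotives, 7.8] [cite: CattaniElZeinGriffithsLe2014, p. 270] -/
theorem Hom.exists_mem_hodgeClasses_apply_eq_iff (f : Hom H H') {p : ℤ} {w : V'} (hw : w ∈ H'.hodgeClasses p) :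
    (∃ v ∈ H.hodgeClasses p, f.toLinearMap v = w) ↔ w ∈ (socle H).toSubmodule.map f.toLinearMap := by
  constructor
  · rintro ⟨v, hv, rfl⟩
    exact ⟨v, hodgeClasses_le_socle H p hv, rfl⟩
  · intro h
    have h' : w ∈ (H.hodgeClasses p).map f.toLinearMap := by
      rw [f.map_hodgeClasses_eq_inf_map_socle p]; exact ⟨hw, h⟩
    obtain ⟨v, hv, rfl⟩ := h'
    exact ⟨v, hv, rfl⟩

/-- `f(Hdgᵖ H) ⊆ Hdgᵖ(H') ∩ soc H' ∩ Im f` (images of socles lie in socles). [cite: Jannsen1990MixedMotives, 7.8]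
[cite: CattaniElZeinGriffithsLe2014, p. 270] -/
theorem Hom.map_hodgeClasses_le_inf_socle (f : Hom H H') (p : ℤ) :
    (H.hodgeClasses p).map f.toLinearMap ≤ H'.hodgeClasses p ⊓ (socle H').toSubmodule ⊓ LinearMap.range f.toLinearMap := by
  rw [f.map_hodgeClasses_eq_inf_map_socle p]
  exact le_inf (inf_le_inf_left _ (map_socle_le f)) (inf_le_right.trans (LinearMap.map_le_range))

/-- **If `f(soc H) ⊇ soc H' ∩ Im f` then every Hodge class in the image lifts**: `f(Hdgᵖ H) = Hdgᵖ(H') ∩ Im f`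
(e.g. `H` semisimple — Jannsen 7.8 a) — or `f` injective with `Im f ∩ soc H' ⊆ f(soc H)`, automatic).
[cite: Jannsen1990MixedMotives, 7.8] [cite: CattaniElZeinGriffithsLe2014, p. 270] -/
theorem Hom.map_hodgeClasses_eq_inf_range_of_socle (f : Hom H H') (p : ℤ)
    (h : (socle H').toSubmodule ⊓ LinearMap.range f.toLinearMap ≤ (socle H).toSubmodule.map f.toLinearMap) :
    (H.hodgeClasses p).map f.toLinearMap = H'.hodgeClasses p ⊓ LinearMap.range f.toLinearMap := by
  refine le_antisymm ((f.map_hodgeClasses_le_inf_socle p).trans (inf_le_inf_right _ inf_le_left)) ?_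
  rw [f.map_hodgeClasses_eq_inf_map_socle p]
  rintro w ⟨hw, hwr⟩
  exact ⟨hw, h ⟨hodgeClasses_le_socle H' p hw, hwr⟩⟩

/-- **Injective morphisms: `f(soc H) = soc H' ∩ Im f`** (`f⁻¹(soc H')` embeds into the semisimple `soc H'`, so it
is semisimple and lies in `soc H`). [cite: CattaniElZeinGriffithsLe2014, Thm. 3.2.18 and p. 270] -/
theorem Hom.map_socle_eq_of_injective (f : Hom H H') (hf : Function.Injective f.toLinearMap) :
    (socle H).toSubmodule.map f.toLinearMap = (socle H').toSubmodule ⊓ LinearMap.range f.toLinearMap := by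
  refine le_antisymm (le_inf (map_socle_le f) LinearMap.map_le_range) ?_
  let K : SubMixedHodgeStructure H := (socle H').comap f
  have hf' : ∀ x ∈ K.toSubmodule, f.toLinearMap x ∈ (socle H').toSubmodule := fun x hx => hx
  have hg : Function.Injective (K.restrictHom (socle H') f hf').toLinearMap := fun x y hxy => by
    have h := congrArg Subtype.val hxy
    change f.toLinearMap x = f.toLinearMap y at h
    exact Subtype.ext (hf h)
  have hK : K.toMixedHodgeStructure.IsSemisimple :=
    ((isSemisimple_socle H').subMixedHodgeStructure (K.restrictHom (socle H') f hf').range).of_bijective' _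
      ((K.restrictHom (socle H') f hf').rangeRestrict_bijective_of_injective hg)
  rintro _ ⟨hw, ⟨x, rfl⟩⟩
  exact ⟨x, le_socle K hK (show f.toLinearMap x ∈ (socle H').toSubmodule from hw), rfl⟩

/-- **The socle of a sub-MHS is `S ∩ soc H`.** [cite: CattaniElZeinGriffithsLe2014, Thm. 3.2.18 and p. 270] -/
theorem SubMixedHodgeStructure.map_subtype_socle (S : SubMixedHodgeStructure H) :
    (socle S.toMixedHodgeStructure).toSubmodule.map S.toSubmodule.subtype = (socle H).toSubmodule ⊓ S.toSubmodule := by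
  have h := S.subtype.map_socle_eq_of_injective (Submodule.injective_subtype _)
  rwa [show LinearMap.range S.subtype.toLinearMap = S.toSubmodule from Submodule.range_subtype _] at h

/-- Injective morphisms: `f(Hdgᵖ H) = Hdgᵖ(H') ∩ Im f`. [cite: Jannsen1990MixedMotives, 7.8] -/
theorem Hom.map_hodgeClasses_eq_inf_range_of_injective (f : Hom H H') (hf : Function.Injective f.toLinearMap) (p : ℤ) :
    (H.hodgeClasses p).map f.toLinearMap = H'.hodgeClasses p ⊓ LinearMap.range f.toLinearMap :=
  f.map_hodgeClasses_eq_inf_range_of_socle p (by rw [f.map_socle_eq_of_injective hf])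

/-- **Surjective morphisms: `f(rad H) = rad H'`** (`H'/f(rad H)` is a quotient of the semisimple `H / rad H`).
[cite: CattaniElZeinGriffithsLe2014, Thm. 3.2.18 and p. 270] -/
theorem Hom.map_radical_eq_of_surjective (f : Hom H H') (hf : Function.Surjective f.toLinearMap) :
    (radical H).toSubmodule.map f.toLinearMap = (radical H').toSubmodule := by
  refine le_antisymm (map_radical_le f) ?_
  let R' : SubMixedHodgeStructure H' := (radical H).map f
  have hq : R'.quotient.IsSemisimple := by
    refine (isSemisimple_quotient_radical H).of_surjective ((radical H).quotientMap R' f fun x hx => ⟨x, hx, rfl⟩) ?_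
    intro y
    obtain ⟨y, rfl⟩ := Submodule.mkQ_surjective _ y
    obtain ⟨x, rfl⟩ := hf y
    exact ⟨Submodule.Quotient.mk x, rfl⟩
  exact radical_le R' hq

/-- **The radical of a quotient is the image of the radical**: `rad(H/S) = (rad H + S)/S`.
[cite: CattaniElZeinGriffithsLe2014, Thm. 3.2.18 and p. 270] -/
theorem SubMixedHodgeStructure.map_mkQ_radical (S : SubMixedHodgeStructure H) :
    (radical H).toSubmodule.map S.toSubmodule.mkQ = (radical S.quotient).toSubmodule :=
  S.mkQ.map_radical_eq_of_surjective (Submodule.mkQ_surjective _)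

end MixedHodgeStructure

end Literature.AlgebraicGeometry.Motives
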